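import Summits.Ventures.WeilGRH.UniformConductorFloorJointCertSound
import HarnessLib

/-!
# GRH arm (rh-explicit, venture WeilGRH): soundness of the joint cell certificate checker, II — the r-adic grid

Cell `rh-explicit`, WEIL TRACK — GRH ARM (weil-grh-1).  For a `JointCert c` on the grid `r = (R−1)/R`, `δ = 2 log(R/(R−1))`:
`exp_grid` / `integral_exp_slab` (`e^{−2(m+x)kδ} = r^{a_m k}`, `∫_{kδ}^{(k+1)δ} e^{−2(m+x)|u|} du = (2/a_m)(r^{a_m k} − r^{a_m(k+1)})`,
`a_m = 4m + 1 + 2κ`: the archimedean slab masses are rational), `sum_slab_le_Ibar` (`checkSlabs` ⇒ the slab-mass bounds) and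
`Clow_le` (`checkConst` ⇒ the constant bound).  Everything is PROVED; no definitions; no named facts. [folklore]
-/

noncomputable section

open Real MeasureTheory Finset Set
open scoped ArithmeticFunction.vonMangoldt

namespace Summit.Ventures.WeilGRH

open Literature.NumberTheory.LFunctions

namespace UniformFloor

namespace JointCert

variable (c : JointCert)

/-! ## The grid -/

/-- `R > 1` and `R − 1 > 0` as reals. [folklore] -/
theorem R_facts (hR : 2 ≤ c.R) : (1 : ℝ) < c.R ∧ (0 : ℝ) < (c.R : ℝ) - 1 ∧ ((c.R - 1 : ℕ) : ℝ) = (c.R : ℝ) - 1 := by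
  have h1 : (1 : ℝ) < c.R := by exact_mod_cast (by omega : 1 < c.R)
  refine ⟨h1, by linarith, ?_⟩
  rw [Nat.cast_sub (by omega), Nat.cast_one]

/-- `0 < r < 1`. [folklore] -/
theorem r_pos_lt_one (hR : 2 ≤ c.R) : 0 < c.r ∧ c.r < 1 := by
  obtain ⟨h1, h2, -⟩ := c.R_facts hR
  unfold r
  exact ⟨div_pos h2 (by linarith), (div_lt_one (by linarith)).2 (by linarith)⟩

/-- `δ = −2 log r`. [folklore] -/
theorem delta_eq (hR : 2 ≤ c.R) : c.δ = -2 * Real.log c.r := by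
  obtain ⟨h1, h2, -⟩ := c.R_facts hR
  unfold δ r
  rw [show (c.R : ℝ) / ((c.R : ℝ) - 1) = ((((c.R : ℝ) - 1) / c.R))⁻¹ by rw [inv_div], Real.log_inv]
  ring

/-- `δ > 0`. [folklore] -/
theorem delta_pos (hR : 2 ≤ c.R) : 0 < c.δ := by
  obtain ⟨hr0, hr1⟩ := c.r_pos_lt_one hR
  rw [c.delta_eq hR]
  have := Real.log_neg hr0 hr1
  linarith

/-- `2t/J = δ`. [folklore] -/
theorem two_t_div (hJ : 0 < c.J) : 2 * c.t / c.J = c.δ := by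
  unfold t
  have : (c.J : ℝ) ≠ 0 := by positivity
  field_simp

/-- `t = J log(R/(R−1)) = log((R/(R−1))^J)`. [folklore] -/
theorem t_eq_log : c.t = Real.log (((c.R : ℝ) / ((c.R : ℝ) - 1)) ^ c.J) := by
  rw [Real.log_pow]
  unfold t δ
  ring

/-- `t > 0`. [folklore] -/
theorem t_pos (hR : 2 ≤ c.R) (hJ : 0 < c.J) : 0 < c.t := by
  have := c.delta_pos hR
  unfold t
  positivity

/-- **On the grid the exponentials are powers of `r`**: `e^{−2(m + ¼ + κ/2)·kδ} = r^{a_m k}`. [folklore] -/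
theorem exp_grid (hR : 2 ≤ c.R) (m k : ℕ) :
    Real.exp (-(2 * ((m : ℝ) + (1 / 4 + (c.κ : ℝ) / 2)) * ((k : ℝ) * c.δ))) = c.r ^ (c.aexp m * k) := by
  obtain ⟨hr0, -⟩ := c.r_pos_lt_one hR
  have e : -(2 * ((m : ℝ) + (1 / 4 + (c.κ : ℝ) / 2)) * ((k : ℝ) * c.δ)) = ((c.aexp m * k : ℕ) : ℝ) * Real.log c.r := by
    rw [c.delta_eq hR]
    unfold aexp
    push_cast
    ring
  rw [e, Real.exp_nat_mul, Real.exp_log hr0]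

/-- **The slab masses are rational**: `∫_{kδ}^{(k+1)δ} e^{−2(m+¼+κ/2)|u|} du = (2/a_m)(r^{a_m k} − r^{a_m(k+1)})`. [folklore] -/
theorem integral_exp_slab (hR : 2 ≤ c.R) (m k : ℕ) :
    ∫ u in ((k : ℝ) * c.δ)..(((k : ℝ) + 1) * c.δ), Real.exp (-(2 * ((m : ℝ) + (1 / 4 + (c.κ : ℝ) / 2)) * |u|)) =
      2 / (c.aexp m : ℝ) * (c.r ^ (c.aexp m * k) - c.r ^ (c.aexp m * (k + 1))) := by
  have hδ := c.delta_pos hR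
  have hl : (0 : ℝ) < 2 * ((m : ℝ) + (1 / 4 + (c.κ : ℝ) / 2)) := by positivity
  have hab : (k : ℝ) * c.δ ≤ ((k : ℝ) + 1) * c.δ := by nlinarith
  rw [intervalIntegral.integral_congr (g := fun u ↦ Real.exp (-(2 * ((m : ℝ) + (1 / 4 + (c.κ : ℝ) / 2)) * u)))
    (fun u hu ↦ by
      rw [uIcc_of_le hab] at hu
      have hu0 : 0 ≤ u := le_trans (by positivity) hu.1
      simp only [abs_of_nonneg hu0])]
  have hl' : (2 * ((m : ℝ) + (1 / 4 + (c.κ : ℝ) / 2))) ≠ 0 := hl.ne'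
  have hderiv : ∀ u ∈ uIcc ((k : ℝ) * c.δ) (((k : ℝ) + 1) * c.δ),
      HasDerivAt (fun u ↦ -(1 / (2 * ((m : ℝ) + (1 / 4 + (c.κ : ℝ) / 2)))) *
        Real.exp (-(2 * ((m : ℝ) + (1 / 4 + (c.κ : ℝ) / 2)) * u)))
        (Real.exp (-(2 * ((m : ℝ) + (1 / 4 + (c.κ : ℝ) / 2)) * u))) u := by
    intro u _
    have h1 : HasDerivAt (fun u : ℝ ↦ -(2 * ((m : ℝ) + (1 / 4 + (c.κ : ℝ) / 2)) * u))
        (-(2 * ((m : ℝ) + (1 / 4 + (c.κ : ℝ) / 2)))) u := by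
      have h := (hasDerivAt_id u).const_mul (-(2 * ((m : ℝ) + (1 / 4 + (c.κ : ℝ) / 2))))
      simpa only [id, mul_one, neg_mul] using h
    refine ((h1.exp).const_mul (-(1 / (2 * ((m : ℝ) + (1 / 4 + (c.κ : ℝ) / 2)))))).congr_deriv ?_
    field_simp
  have hcont : Continuous fun u : ℝ ↦ Real.exp (-(2 * ((m : ℝ) + (1 / 4 + (c.κ : ℝ) / 2)) * u)) := by fun_prop
  rw [intervalIntegral.integral_eq_sub_of_hasDerivAt hderiv (hcont.intervalIntegrable _ _)]
  have e1 := c.exp_grid hR m k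
  have e2 := c.exp_grid hR m (k + 1)
  push_cast at e2
  rw [e1, e2]
  have ha : (c.aexp m : ℝ) = 2 * (2 * ((m : ℝ) + (1 / 4 + (c.κ : ℝ) / 2))) := by
    unfold aexp; push_cast; ring
  rw [ha]
  field_simp
  ring_nf

/-- The layer sum of a slab in closed form. [folklore] -/
theorem sum_integral_exp_slab (hR : 2 ≤ c.R) (k : ℕ) :
    ∑ m ∈ range c.M, ∫ u in ((k : ℝ) * c.δ)..(((k : ℝ) + 1) * c.δ),
        Real.exp (-(2 * ((m : ℝ) + (1 / 4 + (c.κ : ℝ) / 2)) * |u|)) =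
      ∑ m ∈ range c.M, 2 / (c.aexp m : ℝ) * (c.r ^ (c.aexp m * k) - c.r ^ (c.aexp m * (k + 1))) :=
  sum_congr rfl fun m _ ↦ c.integral_exp_slab hR m k

/-! ## The slab table -/

/-- Casting one term of the slab test: `2(L/a)(R−1)^{ak}(R^a − (R−1)^a)R^{E−a(k+1)} = L·R^E·(2/a)(r^{ak} − r^{a(k+1)})`.
[folklore] -/
theorem slab_term_cast (hR : 2 ≤ c.R) {m k E : ℕ} (hE : c.aexp m * (k + 1) ≤ E) (hdvd : c.aexp m ∣ c.L) :
    ((2 * (c.L / c.aexp m) * ((c.R - 1) ^ (c.aexp m * k) * (c.R ^ c.aexp m - (c.R - 1) ^ c.aexp m) *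
        c.R ^ (E - c.aexp m * (k + 1))) : ℕ) : ℝ) =
      (c.L : ℝ) * (c.R : ℝ) ^ E * (2 / (c.aexp m : ℝ) * (c.r ^ (c.aexp m * k) - c.r ^ (c.aexp m * (k + 1)))) := by
  obtain ⟨h1, _, hcast⟩ := c.R_facts hR
  obtain ⟨e, he⟩ := Nat.exists_eq_add_of_le hE
  have hsub : E - c.aexp m * (k + 1) = e := by omega
  have hpow : (c.R - 1) ^ c.aexp m ≤ c.R ^ c.aexp m := Nat.pow_le_pow_left (Nat.sub_le _ _) _
  have ha0 : (c.aexp m : ℝ) ≠ 0 := by unfold aexp; positivity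
  have hR0 : (c.R : ℝ) ≠ 0 := by positivity
  rw [hsub, he, show c.aexp m * (k + 1) = c.aexp m * k + c.aexp m by ring]
  unfold r
  push_cast [Nat.cast_div hdvd ha0, Nat.cast_sub hpow, hcast, div_pow]
  field_simp
  ring

/-- **`checkSlabs` bounds every slab mass**: for `k0 ≤ k < J`,
`Σ_m (2/a_m)(r^{a_m k} − r^{a_m(k+1)}) ≤ B_{k−k0}/D`. [folklore] -/
theorem sum_slab_le_Ibar (hsh : c.checkShape = true) (hsl : c.checkSlabs = true) {k : ℕ} (hk0 : c.k0 ≤ k)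
    (hkJ : k < c.J) :
    ∑ m ∈ range c.M, 2 / (c.aexp m : ℝ) * (c.r ^ (c.aexp m * k) - c.r ^ (c.aexp m * (k + 1))) ≤
      ((c.slabB.getD (k - c.k0) 0 : ℕ) : ℝ) / c.D := by
  obtain ⟨hR, _, _, _, hD, hM, _, _, _, _, hL, hdvd⟩ := c.shape_of_checkShape hsh
  have hD' : (0 : ℝ) < c.D := by exact_mod_cast hD
  unfold checkSlabs at hsl
  have h := of_all_range' hsl (Nat.zero_le (k - c.k0)) (by omega : k - c.k0 < 0 + (c.J - c.k0))
  unfold slabOK at h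
  rw [decide_eq_true_eq, Nat.add_sub_cancel' hk0, sum_map_range'_zero] at h
  set E := c.aexp (c.M - 1) * (k + 1) with hE
  set S := ∑ m ∈ range c.M, 2 / (c.aexp m : ℝ) * (c.r ^ (c.aexp m * k) - c.r ^ (c.aexp m * (k + 1))) with hS
  have hEm : ∀ m ∈ range c.M, c.aexp m * (k + 1) ≤ E := fun m hm ↦ by
    have := mem_range.1 hm
    have : c.aexp m ≤ c.aexp (c.M - 1) := by unfold aexp; omega
    exact Nat.mul_le_mul_right _ this
  have hLR : (0 : ℝ) < (c.L : ℝ) * (c.R : ℝ) ^ E := by positivity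
  have key : (c.D : ℝ) * S * ((c.L : ℝ) * (c.R : ℝ) ^ E) ≤ (c.slabB.getD (k - c.k0) 0 : ℝ) * ((c.L : ℝ) * (c.R : ℝ) ^ E) := by
    have hc : ((c.D * ∑ m ∈ range c.M, 2 * (c.L / c.aexp m) * ((c.R - 1) ^ (c.aexp m * k) *
        (c.R ^ c.aexp m - (c.R - 1) ^ c.aexp m) * c.R ^ (E - c.aexp m * (k + 1))) : ℕ) : ℝ) ≤
        ((c.slabB.getD (k - c.k0) 0 * c.L * c.R ^ E : ℕ) : ℝ) := (Nat.cast_le (α := ℝ)).mpr h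
    rw [Nat.cast_mul c.D, Nat.cast_sum, sum_congr rfl fun m hm ↦ c.slab_term_cast hR (hEm m hm) (hdvd m (mem_range.1 hm)),
      ← mul_sum] at hc
    push_cast at hc
    rw [hS]
    linarith
  have key2 : (c.D : ℝ) * S ≤ (c.slabB.getD (k - c.k0) 0 : ℝ) := le_of_mul_le_mul_right key hLR
  rw [le_div_iff₀ hD', mul_comm]
  exact key2

/-! ## The constant -/

/-- Casting one term of the constant test: `4(L/a)(R−1)^{ak0}R^{A−ak0} = L·R^A·(4/a)r^{ak0}`. [folklore] -/
theorem const_term_cast (hR : 2 ≤ c.R) {m A : ℕ} (hA : c.aexp m * c.k0 ≤ A) (hdvd : c.aexp m ∣ c.L) :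
    ((4 * (c.L / c.aexp m) * ((c.R - 1) ^ (c.aexp m * c.k0) * c.R ^ (A - c.aexp m * c.k0)) : ℕ) : ℝ) =
      (c.L : ℝ) * (c.R : ℝ) ^ A * (4 / (c.aexp m : ℝ) * c.r ^ (c.aexp m * c.k0)) := by
  obtain ⟨h1, _, hcast⟩ := c.R_facts hR
  obtain ⟨e, he⟩ := Nat.exists_eq_add_of_le hA
  have hsub : A - c.aexp m * c.k0 = e := by omega
  have ha0 : (c.aexp m : ℝ) ≠ 0 := by unfold aexp; positivity
  have hR0 : (c.R : ℝ) ≠ 0 := by positivity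
  rw [hsub, he]
  unfold r
  push_cast [Nat.cast_div hdvd ha0, hcast, div_pow]
  field_simp
  ring

/-- `4(L/a)` cast. [folklore] -/
theorem four_div_cast {m : ℕ} (hdvd : c.aexp m ∣ c.L) :
    ((4 * (c.L / c.aexp m) : ℕ) : ℝ) = (c.L : ℝ) * (4 / (c.aexp m : ℝ)) := by
  have ha0 : (c.aexp m : ℝ) ≠ 0 := by unfold aexp; positivity
  rw [Nat.cast_mul, Nat.cast_div hdvd ha0]
  push_cast
  ring

/-- Telescoping over the slabs: `Σ_{k0≤k<K} (r^{ak} − r^{a(k+1)}) = r^{a k0} − r^{a K}`. [folklore] -/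
theorem sum_Ico_pow_sub {a k0 K : ℕ} (hk : k0 ≤ K) (x : ℝ) :
    ∑ k ∈ Ico k0 K, (x ^ (a * k) - x ^ (a * (k + 1))) = x ^ (a * k0) - x ^ (a * K) := by
  rw [sum_Ico_eq_sum_range]
  have h := sum_range_sub' (fun i ↦ x ^ (a * (k0 + i))) (K - k0)
  simp only [add_zero, Nat.add_sub_cancel' hk] at h
  rw [← h]
  exact sum_congr rfl fun i _ ↦ by rw [add_assoc]

/-- **`checkConst` bounds the constant**: `Clow/D ≤ 2 Σ_{k0≤k<K} Σ_m ∫_{kδ}^{(k+1)δ} e^{−2(m+x)|u|} du`. [folklore] -/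
theorem Clow_le (hsh : c.checkShape = true) (hco : c.checkConst = true) :
    (c.Clow : ℝ) / c.D ≤ 2 * ∑ k ∈ Ico c.k0 c.K, ∑ m ∈ range c.M,
      ∫ u in ((k : ℝ) * c.δ)..(((k : ℝ) + 1) * c.δ), Real.exp (-(2 * ((m : ℝ) + (1 / 4 + (c.κ : ℝ) / 2)) * |u|)) := by
  obtain ⟨hR, hk0J, hJK, _, hD, hM, _, _, _, _, hL, hdvd⟩ := c.shape_of_checkShape hsh
  obtain ⟨hr0, hr1⟩ := c.r_pos_lt_one hR
  have hD' : (0 : ℝ) < c.D := by exact_mod_cast hD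
  have hk : c.k0 ≤ c.K := by omega
  -- the right-hand side in closed form, and its lower bound
  have hrhs : 2 * ∑ k ∈ Ico c.k0 c.K, ∑ m ∈ range c.M,
      ∫ u in ((k : ℝ) * c.δ)..(((k : ℝ) + 1) * c.δ), Real.exp (-(2 * ((m : ℝ) + (1 / 4 + (c.κ : ℝ) / 2)) * |u|)) =
      ∑ m ∈ range c.M, 4 / (c.aexp m : ℝ) * (c.r ^ (c.aexp m * c.k0) - c.r ^ (c.aexp m * c.K)) := by
    rw [sum_congr rfl fun k _ ↦ c.sum_integral_exp_slab hR k, sum_comm, mul_sum]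
    refine sum_congr rfl fun m _ ↦ ?_
    rw [← mul_sum, sum_Ico_pow_sub hk]
    ring
  have hlow : ∑ m ∈ range c.M, 4 / (c.aexp m : ℝ) * (c.r ^ (c.aexp m * c.k0) - c.r ^ c.K) ≤
      ∑ m ∈ range c.M, 4 / (c.aexp m : ℝ) * (c.r ^ (c.aexp m * c.k0) - c.r ^ (c.aexp m * c.K)) := by
    refine sum_le_sum fun m _ ↦ mul_le_mul_of_nonneg_left ?_ (by positivity)
    have : c.r ^ (c.aexp m * c.K) ≤ c.r ^ c.K :=
      pow_le_pow_of_le_one hr0.le hr1.le (Nat.le_mul_of_pos_left c.K (by unfold aexp; omega))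
    linarith
  -- the integer test
  unfold checkConst at hco
  rw [decide_eq_true_eq, sum_map_range'_zero, sum_map_range'_zero] at hco
  set A := c.aexp (c.M - 1) * c.k0 with hA
  have hAm : ∀ m ∈ range c.M, c.aexp m * c.k0 ≤ A := fun m hm ↦ by
    have := mem_range.1 hm
    have : c.aexp m ≤ c.aexp (c.M - 1) := by unfold aexp; omega
    exact Nat.mul_le_mul_right _ this
  obtain ⟨_, _, hcast⟩ := c.R_facts hR
  have hP : ((∑ m ∈ range c.M, 4 * (c.L / c.aexp m) : ℕ) : ℝ) = (c.L : ℝ) * ∑ m ∈ range c.M, 4 / (c.aexp m : ℝ) := by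
    rw [Nat.cast_sum, sum_congr rfl fun m hm ↦ c.four_div_cast (hdvd m (mem_range.1 hm)), ← mul_sum]
  have hQ : ((∑ m ∈ range c.M, 4 * (c.L / c.aexp m) * ((c.R - 1) ^ (c.aexp m * c.k0) * c.R ^ (A - c.aexp m * c.k0)) :
      ℕ) : ℝ) = (c.L : ℝ) * (c.R : ℝ) ^ A * ∑ m ∈ range c.M, 4 / (c.aexp m : ℝ) * c.r ^ (c.aexp m * c.k0) := by
    rw [Nat.cast_sum, sum_congr rfl fun m hm ↦ c.const_term_cast hR (hAm m hm) (hdvd m (mem_range.1 hm)), ← mul_sum]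
  have hc := (Nat.cast_le (α := ℝ)).mpr hco
  simp only [Nat.cast_add, Nat.cast_mul, Nat.cast_pow, hcast, hP, hQ, pow_add] at hc
  -- hc : Clow L (R^A R^K) + D R^A (R-1)^K (L Σ 4/a) ≤ D R^K (L R^A Σ (4/a) r^{a k0})
  have hRK : ((c.R : ℝ) - 1) ^ c.K = c.r ^ c.K * (c.R : ℝ) ^ c.K := by
    unfold r
    rw [← mul_pow]
    congr 1
    field_simp
  rw [hRK] at hc
  have hpos : (0 : ℝ) < (c.L : ℝ) * (c.R : ℝ) ^ A * (c.R : ℝ) ^ c.K := by positivity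
  have key : (c.Clow : ℝ) + c.D * (c.r ^ c.K * ∑ m ∈ range c.M, 4 / (c.aexp m : ℝ)) ≤
      c.D * ∑ m ∈ range c.M, 4 / (c.aexp m : ℝ) * c.r ^ (c.aexp m * c.k0) := by
    refine le_of_mul_le_mul_right ?_ hpos
    convert hc using 1 <;> ring
  rw [hrhs, div_le_iff₀ hD']
  refine le_trans ?_ (mul_le_mul_of_nonneg_right hlow hD'.le)
  rw [sum_congr rfl fun m _ ↦ mul_sub (4 / (c.aexp m : ℝ)) _ _, sum_sub_distrib, ← sum_mul]
  linarith [key]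

end JointCert

end UniformFloor

end Summit.Ventures.WeilGRH

end
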